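import Mathlib.AlgebraicGeometry.Morphisms.Separated
import Mathlib.AlgebraicGeometry.Morphisms.FiniteType
import Mathlib.AlgebraicGeometry.Properties
import Mathlib.RingTheory.Localization.Ideal
import Mathlib.RingTheory.Localization.AtPrime.Basic
import HarnessLib

/-!
# The hypersurface `Spec (S ⧸ (g)) → Spec k` and its stalks (crux `FrobeniusLadder.FRationalResolution`, line `Sketch`)

Stub `stub_specHypersurface` (worker W6) of the skeleton `Sketch` for crux
stmt-ResolutionOfSingularities-15317: the SCHEME GLUE of the suspension calibration. The lead proves,
prime by prime, a ring-level statement `H` about the hypersurface ring `S ⧸ (g)` (`S` a finite type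
`k`-algebra, later `S = k[x][y, z]`, `g = yz + f`): for every prime `P ∋ g` of `S` the ring
`S_P ⧸ (g)` is a domain in which every ideal is tightly closed in the crux's inline sense
(`c ≠ 0`, `c · y^(p^e) ∈ span {z^(p^e) | z ∈ I}` for all `e` `⇒ y ∈ I`). This file turns `H` into
the statement about the `k`-scheme `X = Spec (S ⧸ (g))`:

* `X → Spec k` is separated, locally of finite type and quasi-compact (Mathlib instances for
  `Spec.map`, and `HasRingHomProperty.Spec_iff` + `Algebra.FiniteType k (S ⧸ (g))`);
* every stalk `𝒪_{X,x}` is a domain with all ideals tightly closed, because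
  `𝒪_{X,x} ≅ (S ⧸ (g))_𝔭 ≅ S_P ⧸ (g)` for `P` the preimage of `𝔭 ↔ x`
  (`Spec.stalkIso`; localization commutes with quotients: Mathlib's instance
  `IsLocalization (algebraMapSubmonoid (S ⧸ I) M) (S_M ⧸ I S_M)` with the submonoid identified with
  `𝔭.primeCompl`), and the clause is invariant under ring isomorphisms
  (`allIdeals_clause_of_ringEquiv`, the all-ideals analogue of
  `ClauseInvariance.stub_clause_of_ringEquiv`);
* hence `X` is reduced (`isReduced_of_isReduced_stalk`);
* conversely every prime `P ∋ g` of `S` is hit: the point `x = P ⧸ (g)` has `𝒪_{X,x} ≅ S_P ⧸ (g)`.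

All of it is folklore scheme glue over Mathlib; no published fact is used.
-/

-- single-problem summit: the doubled namespace component is forced
set_option linter.dupNamespace false

noncomputable section

namespace Summit.ResolutionOfSingularities.ResolutionOfSingularities.Theorems.FRationalResolution

open CategoryTheory AlgebraicGeometry TopologicalSpace

/-- **The all-ideals tight-closure clause transports along ring isomorphisms.** If `e : A ≃+* B` and
every ideal of `B` is tightly closed in the inline sense (`c ≠ 0` and
`c · y^(p^n) ∈ span {z^(p^n) | z ∈ I}` for all `n` force `y ∈ I`), then so is every ideal of `A`:
apply the clause in `B` to `e y`, `e c` and the ideal `e(I) = I.comap e.symm`.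
(All-ideals analogue of `ClauseInvariance.symm_mem_span_pow_image` /
`ClauseInvariance.stub_clause_of_ringEquiv`, which treat parameter ideals.) -/
theorem allIdeals_clause_of_ringEquiv (p : ℕ) {A B : Type} [CommRing A] [CommRing B]
    (e : A ≃+* B)
    (h : ∀ (I : Ideal B) (y c : B), c ≠ 0 →
      (∀ n : ℕ, c * y ^ p ^ n ∈ Ideal.span ((fun z : B => z ^ p ^ n) '' (I : Set B))) → y ∈ I) :
    ∀ (I : Ideal A) (y c : A), c ≠ 0 →
      (∀ n : ℕ, c * y ^ p ^ n ∈ Ideal.span ((fun z : A => z ^ p ^ n) '' (I : Set A))) → y ∈ I := by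
  intro I y c hc hy
  -- adapted from `ClauseInvariance.symm_mem_span_pow_image` (parameter-ideal version)
  have key := h (I.comap e.symm.toRingHom) (e y) (e c) (e.map_ne_zero_iff.mpr hc) ?_
  · simpa [Ideal.mem_comap] using key
  · intro n
    have h1 : e (c * y ^ p ^ n) ∈
        (Ideal.span ((fun z : A => z ^ p ^ n) '' (I : Set A))).map e :=
      Ideal.mem_map_of_mem _ (hy n)
    rw [map_mul, map_pow, Ideal.map_span] at h1
    refine Ideal.span_mono ?_ h1
    rintro _ ⟨_, ⟨z, hz, rfl⟩, rfl⟩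
    refine ⟨e z, ?_, ?_⟩
    · simpa [Ideal.mem_comap] using hz
    · simp only [map_pow]

/-- **Localization commutes with passing to the hypersurface ring.** For `g ∈ S`, a prime `𝔭` of
`S ⧸ (g)` and its preimage `P` in `S`: `(S ⧸ (g))_𝔭 ≃+* S_P ⧸ (g)`. Proof: Mathlib's instance makes
`S_P ⧸ (g) S_P` the localization of `S ⧸ (g)` at the image of `P.primeCompl`, which is
`𝔭.primeCompl` (`S → S ⧸ (g)` is onto and `P` is the full preimage of `𝔭`); conclude with
`IsLocalization.algEquiv` and `(g) S_P = (g / 1)` (`Ideal.map_span`). [folklore] -/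
theorem nonempty_localization_ringEquiv_localization_quotient (S : Type) [CommRing S] (g : S)
    (𝔭 : Ideal (S ⧸ Ideal.span {g})) [𝔭.IsPrime] (P : Ideal S) [P.IsPrime]
    (hP : 𝔭.comap (Ideal.Quotient.mk (Ideal.span {g})) = P) :
    Nonempty (Localization.AtPrime 𝔭 ≃+*
      Localization.AtPrime P ⧸ Ideal.span {algebraMap S (Localization.AtPrime P) g}) := by
  subst hP
  haveI inst : IsLocalization (Algebra.algebraMapSubmonoid (S ⧸ Ideal.span {g})
      (𝔭.comap (Ideal.Quotient.mk (Ideal.span {g}))).primeCompl)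
      (Localization.AtPrime (𝔭.comap (Ideal.Quotient.mk (Ideal.span {g}))) ⧸
        (Ideal.span {g}).map (algebraMap S
          (Localization.AtPrime (𝔭.comap (Ideal.Quotient.mk (Ideal.span {g})))))) :=
    inferInstance
  -- the image of `P.primeCompl` in `S ⧸ (g)` is `𝔭.primeCompl`
  have hM : Algebra.algebraMapSubmonoid (S ⧸ Ideal.span {g})
      (𝔭.comap (Ideal.Quotient.mk (Ideal.span {g}))).primeCompl = 𝔭.primeCompl := by
    ext r
    constructor
    · rintro ⟨s, hs, rfl⟩
      exact hs
    · intro hr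
      obtain ⟨s, rfl⟩ := Ideal.Quotient.mk_surjective r
      exact ⟨s, hr, rfl⟩
  rw [hM] at inst
  have hIm : (Ideal.span {g}).map (algebraMap S
      (Localization.AtPrime (𝔭.comap (Ideal.Quotient.mk (Ideal.span {g}))))) =
      Ideal.span {algebraMap S _ g} := by
    rw [Ideal.map_span, Set.image_singleton]
  exact ⟨(IsLocalization.algEquiv 𝔭.primeCompl (Localization.AtPrime 𝔭)
    (Localization.AtPrime (𝔭.comap (Ideal.Quotient.mk (Ideal.span {g}))) ⧸
      (Ideal.span {g}).map (algebraMap S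
        (Localization.AtPrime (𝔭.comap (Ideal.Quotient.mk (Ideal.span {g}))))))).toRingEquiv.trans
    (Ideal.quotEquivOfEq hIm)⟩

/-- **Stalks of the hypersurface `X = Spec (S ⧸ (g))`.** For a point `x` of `X` (a prime `𝔭` of
`S ⧸ (g)`) and `P` the preimage of `𝔭` in `S`: `𝒪_{X,x} ≃+* S_P ⧸ (g)`, composing Mathlib's
`Spec.stalkIso` (`𝒪_{X,x} ≅ (S ⧸ (g))_𝔭`) with
`nonempty_localization_ringEquiv_localization_quotient`. [folklore] -/
theorem nonempty_stalk_ringEquiv_localization_quotient (S : Type) [CommRing S] (g : S)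
    (x : Spec (CommRingCat.of (S ⧸ Ideal.span {g}))) (P : Ideal S) [P.IsPrime]
    (hP : x.asIdeal.comap (Ideal.Quotient.mk (Ideal.span {g})) = P) :
    Nonempty ((Spec (CommRingCat.of (S ⧸ Ideal.span {g}))).presheaf.stalk x ≃+*
      Localization.AtPrime P ⧸ Ideal.span {algebraMap S (Localization.AtPrime P) g}) := by
  obtain ⟨e⟩ := nonempty_localization_ringEquiv_localization_quotient S g x.asIdeal P hP
  exact ⟨(Spec.stalkIso (CommRingCat.of (S ⧸ Ideal.span {g})) x).commRingCatIsoToRingEquiv.trans e⟩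

/-- **Scheme glue for the hypersurface `X = Spec (S ⧸ (g)) → Spec k`** (stub `stub_specHypersurface`
of the skeleton `Sketch`, crux stmt-ResolutionOfSingularities-15317). Let `S` be a `k`-algebra of
finite type, `g ∈ S`, and suppose (`H`) that for every prime `P ∋ g` of `S` the ring `S_P ⧸ (g)` is
a domain all of whose ideals are tightly closed in the inline sense. Then for `R = S ⧸ (g)`,
`X = Spec R` and `φ : X → Spec k` the structure morphism:
`φ` is separated, locally of finite type and quasi-compact (instances for `Spec.map`;
`HasRingHomProperty.Spec_iff` and `Algebra.FiniteType k R`), every stalk `𝒪_{X,x}` is a domain with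
all ideals tightly closed (transport of `H` along `𝒪_{X,x} ≃+* S_P ⧸ (g)`, `P` the preimage of `x`,
`nonempty_stalk_ringEquiv_localization_quotient` and `allIdeals_clause_of_ringEquiv`), `X` is
reduced (`isReduced_of_isReduced_stalk`), and every prime `P ∋ g` of `S` is the preimage of the point
`x = P ⧸ (g)` of `X`, with `𝒪_{X,x} ≃+* S_P ⧸ (g)`. [folklore] -/
theorem stub_specHypersurface (p : ℕ) (k : Type) [Field k] (S : Type) [CommRing S] [Algebra k S]
    [Algebra.FiniteType k S] (g : S)
    (H : ∀ (P : Ideal S) [P.IsPrime], g ∈ P →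
      IsDomain (Localization.AtPrime P ⧸ Ideal.span {algebraMap S (Localization.AtPrime P) g}) ∧
      ∀ (I : Ideal (Localization.AtPrime P ⧸ Ideal.span {algebraMap S (Localization.AtPrime P) g}))
        (y c : Localization.AtPrime P ⧸ Ideal.span {algebraMap S (Localization.AtPrime P) g}),
        c ≠ 0 →
        (∀ e : ℕ, c * y ^ p ^ e ∈ Ideal.span
          ((fun z : Localization.AtPrime P ⧸ Ideal.span {algebraMap S (Localization.AtPrime P) g} =>
            z ^ p ^ e) '' (I : Set (Localization.AtPrime P ⧸
              Ideal.span {algebraMap S (Localization.AtPrime P) g})))) →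
        y ∈ I) :
    let R := S ⧸ Ideal.span {g}
    let X := Spec (CommRingCat.of R)
    let φ : X ⟶ Spec (CommRingCat.of k) := Spec.map (CommRingCat.ofHom (algebraMap k R))
    IsSeparated φ ∧ LocallyOfFiniteType φ ∧ QuasiCompact φ ∧ IsReduced X ∧
    (∀ x : X, IsDomain (X.presheaf.stalk x) ∧
      ∀ (I : Ideal (X.presheaf.stalk x)) (y c : X.presheaf.stalk x), c ≠ 0 →
        (∀ e : ℕ, c * y ^ p ^ e ∈
          Ideal.span ((fun z : X.presheaf.stalk x => z ^ p ^ e) '' (I : Set (X.presheaf.stalk x)))) →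
        y ∈ I) ∧
    (∀ (P : Ideal S) [P.IsPrime], g ∈ P → ∃ x : X,
      Nonempty (X.presheaf.stalk x ≃+*
        Localization.AtPrime P ⧸ Ideal.span {algebraMap S (Localization.AtPrime P) g})) := by
  intro R X φ
  -- every stalk is `S_P ⧸ (g)` for the preimage `P ∋ g` of the point; transport `H`
  have hstalk : ∀ x : X, IsDomain (X.presheaf.stalk x) ∧
      ∀ (I : Ideal (X.presheaf.stalk x)) (y c : X.presheaf.stalk x), c ≠ 0 →
        (∀ e : ℕ, c * y ^ p ^ e ∈
          Ideal.span ((fun z : X.presheaf.stalk x => z ^ p ^ e) ''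
            (I : Set (X.presheaf.stalk x)))) →
        y ∈ I := by
    intro x
    haveI : (x.asIdeal.comap (Ideal.Quotient.mk (Ideal.span {g}))).IsPrime :=
      Ideal.comap_isPrime _ _
    have hg : g ∈ x.asIdeal.comap (Ideal.Quotient.mk (Ideal.span {g})) := by
      rw [Ideal.mem_comap, Ideal.Quotient.eq_zero_iff_mem.mpr (Ideal.mem_span_singleton_self g)]
      exact Ideal.zero_mem _
    obtain ⟨hdom, hcl⟩ := H (x.asIdeal.comap (Ideal.Quotient.mk (Ideal.span {g}))) hg
    obtain ⟨e⟩ := nonempty_stalk_ringEquiv_localization_quotient S g x _ rfl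
    exact ⟨MulEquiv.isDomain _ e.toMulEquiv, allIdeals_clause_of_ringEquiv p e hcl⟩
  -- domains are reduced, so `X` is reduced
  haveI : ∀ x : X, _root_.IsReduced (X.presheaf.stalk x) := fun x => by
    haveI := (hstalk x).1
    infer_instance
  refine ⟨inferInstance, ?_, inferInstance, isReduced_of_isReduced_stalk X, hstalk, ?_⟩
  · -- locally of finite type: `k → S ⧸ (g)` is of finite type
    rw [HasRingHomProperty.Spec_iff (P := @LocallyOfFiniteType)]
    show RingHom.FiniteType (algebraMap k R)
    rw [RingHom.finiteType_algebraMap]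
    infer_instance
  · -- every prime `P ∋ g` of `S` is the preimage of the point `P ⧸ (g)`
    intro P _ hgP
    have hle : Ideal.span {g} ≤ P := (Ideal.span_singleton_le_iff_mem _).mpr hgP
    haveI hprime : (P.map (Ideal.Quotient.mk (Ideal.span {g}))).IsPrime :=
      Ideal.map_isPrime_of_surjective Ideal.Quotient.mk_surjective (by rwa [Ideal.mk_ker])
    have hcomap : (P.map (Ideal.Quotient.mk (Ideal.span {g}))).comap
        (Ideal.Quotient.mk (Ideal.span {g})) = P := by
      rw [Ideal.comap_map_of_surjective _ Ideal.Quotient.mk_surjective, ← RingHom.ker_eq_comap_bot,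
        Ideal.mk_ker]
      exact sup_eq_left.mpr hle
    exact ⟨⟨P.map (Ideal.Quotient.mk (Ideal.span {g})), hprime⟩,
      nonempty_stalk_ringEquiv_localization_quotient S g ⟨_, hprime⟩ P hcomap⟩

end Summit.ResolutionOfSingularities.ResolutionOfSingularities.Theorems.FRationalResolution

end
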